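/-
Copyright (c) 2026 the pub-hodgecm-mathlib formalisation cell (harness21).  Prover seat hodgecm-mathlib-K2Liu-p02 (g7), Track B «K2-LIT» ∕ hLiu418
#184♮, #42S payer road (σ), V5-inst (f) `htrans` of ★ V8e `face_two_of_laws` (LEAD F0P6-plan (g14) BATCH #13 (4)(f), #16 (1), #17 (3); K2Liu-p02 (g7) census
12:30:47Z, pre-census note 13:10:33Z).  THEOREMS ONLY.
-/
import Summits.HodgeConjecture.HodgeConjecture.Theorems.K2LiuNullConeOrbits            -- ★ (O1) `exists_unitary_mul_mul_eq_of_null` (field currency)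
import Literature.NumberTheory.Automorphic.UnitaryGroupInertPlaceHyperbolicBasis        -- ★ `galAdicCompletionMap_galAdicCompletionMap_of_smul_eq`, `placeForm_hermitian_of_smul_eq`
import Literature.NumberTheory.Automorphic.AnisotropicUnitaryGroupCompactOfPlace         -- ★ `conjLocal_apply_eq_of_smul_eq`
import HarnessLib

/-!
# Crux `HLiu418`, (σ) V5-inst (f): THE NULL-CONE TRANSITIVITY (O1) IN THE LOCAL-GROUP CURRENCY `U(J)(F_v) ≤ GL₃(E ⊗ F_v)` AT A NON-SPLIT PLACE

Cell `hodgecm-mathlib`, crux item hLiu418 = `stmt-HodgeConjecture-24832`; squad K2 ∕ K2Liu; prover K2Liu-p02 (g7).  THEOREMS ONLY (no `def`, no instance, no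
notation, no named-fact hypothesis, no `sorry`); lane `--supports stmt-HodgeConjecture-24832 --as helper`.

★ (O1) `K2LiuNullConeOrbits.exists_unitary_mul_mul_eq_of_null` (K2Liu-p14) is transitivity of `U(J) × GL₂` on the non-zero null `3 × 2` matrices over a FIELD `L` with
involution `c`.  The binder `htrans` of ★ V8e `face_two_of_laws` lives on the Δ-model of the big doubled space, whose coordinates are matrices over the local ring
`E ⊗_F F_v = Π_{w ∣ v} E_w` (★ `LocalRing E v`), acted on by the local unitary group `U(J)(F_v) = «local» E c 3 J v` (★ `UnitaryGroup.local`: the `conjLocal`-unitary group of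
the local Gram matrix `(adelicForm E 3 J).map (adeleToLocal E v)`).  At a NON-SPLIT place (`c • w = w`: one place `w ∣ v`, `E ⊗ F_v = E_w` a field, ★ `UnitaryGroupNonsplitPlace`)
this file transports (O1) to that currency: **`exists_local_mul_mul_eq_of_null`** — for non-zero null `X, X′ ∈ M_{3×2}(E ⊗ F_v)` there are `g ∈ U(J)(F_v)` and `a ∈ M₂(E ⊗ F_v)` with
`det a` a unit and `g · X · a = X′`.  (At a SPLIT place the statement is false — several rank strata, ★ `K2LiuNullConeOrbitsSplit.rank_mem_strata`; the split road is the stratified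
face.)  Tools: §1 the evaluation `x ↦ x_w` is a ring isomorphism `E ⊗ F_v ≃+* E_w` at a non-split place (`exists_ringEquiv_apply_eq_of_smul_eq`, from ★ `LocalRing.eq_iff_apply_eq`) intertwining
`conjLocal` with `σ_w` (★ `conjLocal_apply_eq_of_smul_eq`) and the local Gram matrix with `placeForm J w` (★ `localForm_map_eval`); §2 the transport.
References: [Kudla1994] §3; [MoeglinVignerasWaldspurger1987] Chap. 3 IV; [CasselsFrohlichANT1967] Ch. II §10, Ch. VII §1.1; [PlatonovRapinchuk1994] §5.1.
HONEST LABEL.  Count-neutral helper: `HC_CM` is proved only modulo the 7 printed citations (2 remaining named inputs: hLiu418 = `stmt-HodgeConjecture-24832`,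
h413 = `stmt-HodgeConjecture-24833`) until rung 0 closes.
-/

set_option autoImplicit false
set_option linter.dupNamespace false -- the mandated namespace repeats `HodgeConjecture.HodgeConjecture`

noncomputable section

open scoped Matrix
open NumberField IsDedekindDomain
open Literature.NumberTheory.Automorphic Literature.NumberTheory.Automorphic.UnitaryGroup
open Summit.HodgeConjecture.HodgeConjecture.Cruxes.HLiu418.K2LiuNullConeOrbits (exists_unitary_mul_mul_eq_of_null)

namespace Summit.HodgeConjecture.HodgeConjecture.Cruxes.HLiu418.K2LiuNullConeOrbitsNonsplitLocal

variable {F E : Type} [Field F] [NumberField F] [Field E] [NumberField E] [Algebra F E] [Algebra.IsQuadraticExtension F E]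
  (c : E ≃ₐ[F] E) (hc : c ≠ 1) {v : HeightOneSpectrum (𝓞 F)} (w : PlacesOver E v) (hw : c • w.1 = w.1)

/-! ## §1 `E ⊗ F_v = E_w` at a non-split place, as a ring isomorphism -/

include hc hw in
/-- **at a non-split place the evaluation `x ↦ x_w` is a ring isomorphism `E ⊗_F F_v ≃+* E_w`** (★ `LocalRing.eq_iff_apply_eq`: one place above `v`).
[cite: CasselsFrohlichANT1967, Ch. II §10] -/
theorem exists_ringEquiv_apply_eq_of_smul_eq :
    ∃ Φ : LocalRing E v ≃+* w.1.adicCompletion E, ∀ x, Φ x = x w := by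
  haveI := PlacesOver.subsingleton_of_smul_eq c hc w hw
  have hinj : Function.Injective (Pi.evalRingHom (fun w' : PlacesOver E v => w'.1.adicCompletion E) w) :=
    fun x y h => (LocalRing.eq_iff_apply_eq c hc w hw x y).2 h
  have hsurj : Function.Surjective (Pi.evalRingHom (fun w' : PlacesOver E v => w'.1.adicCompletion E) w) := by
    intro y
    let x : LocalRing E v := fun w' =>
      cast (congrArg (fun u : PlacesOver E v => u.1.adicCompletion E) (PlacesOver.eq_of_smul_eq c hc w hw w').symm) y
    have hx : x w = y := cast_eq _ _
    exact ⟨x, hx⟩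
  exact ⟨RingEquiv.ofBijective _ ⟨hinj, hsurj⟩, fun x => rfl⟩

/-! ## §2 (O1) in the currency `«local» E c 3 J v ≤ GL₃(E ⊗ F_v)` -/

set_option synthInstance.maxHeartbeats 200000 in -- rectangular products over the Π-type `E ⊗ F_v`: the (failing) coercion search of `binop%` is slow
include hc hw in
/-- **NULL-CONE TRANSITIVITY AT A NON-SPLIT PLACE, LOCAL-GROUP CURRENCY**: for a `c`-hermitian invertible `J ∈ M₃(E)` and non-zero null `X, X′ ∈ M_{3×2}(E ⊗ F_v)`
(`(c⊗1)(X)ᵀ · J_v · X = 0`, `J_v` the local Gram matrix of ★ `UnitaryGroup.local`), there are `g ∈ U(J)(F_v)` and `a ∈ M₂(E ⊗ F_v)` with `det a` a unit and `g · X · a = X′`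
(★ (O1) over the field `E_w`, `w` the place above `v`, transported along §1). [cite: Kudla1994, §3] [cite: MoeglinVignerasWaldspurger1987, Chap. 3 IV] -/
theorem exists_local_mul_mul_eq_of_null (J : Matrix (Fin 3) (Fin 3) E) (hJh : (J.map c)ᵀ = J) (hJdet : J.det ≠ 0)
    (X X' : Matrix (Fin 3) (Fin 2) (LocalRing E v))
    (hX : (X.map (conjLocal E c v))ᵀ * ((adelicForm E 3 J).map (adeleToLocal E v) : Matrix (Fin 3) (Fin 3) (LocalRing E v)) * X = 0) (hX0 : X ≠ 0)
    (hX' : (X'.map (conjLocal E c v))ᵀ * ((adelicForm E 3 J).map (adeleToLocal E v) : Matrix (Fin 3) (Fin 3) (LocalRing E v)) * X' = 0) (hX'0 : X' ≠ 0) :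
    ∃ g : UnitaryGroup.«local» E c 3 J v, ∃ a : Matrix (Fin 2) (Fin 2) (LocalRing E v), IsUnit a.det ∧
      (Units.val (g : GL (Fin 3) (LocalRing E v))) * X * a = X' := by
  obtain ⟨Φ, hΦ⟩ := exists_ringEquiv_apply_eq_of_smul_eq c hc w hw
  -- the dictionary: `Φ ∘ conjLocal = σ_w ∘ Φ`, `J_v ↦ placeForm J w`
  set σ : w.1.adicCompletion E →+* w.1.adicCompletion E := galAdicCompletionMap (L := E) c hw with hσ
  have hΦc : ∀ x, Φ (conjLocal E c v x) = σ (Φ x) := fun x => by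
    rw [hΦ, hΦ, conjLocal_apply_eq_of_smul_eq c hc v w hw]
  have hΦc' : ∀ y, Φ.symm (σ y) = conjLocal E c v (Φ.symm y) := fun y => by
    apply Φ.injective
    rw [RingEquiv.apply_symm_apply, hΦc, RingEquiv.apply_symm_apply]
  have hΦJ : ((adelicForm E 3 J).map (adeleToLocal E v)).map Φ.toRingHom = placeForm J w.1 := by
    rw [← localForm_map_eval E 3 J v w]
    exact Matrix.ext fun i j => hΦ _
  have hΦJ' : (placeForm J w.1).map Φ.symm.toRingHom = (adelicForm E 3 J).map (adeleToLocal E v) := by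
    rw [← hΦJ, Matrix.map_map]
    conv_rhs => rw [← Matrix.map_id ((adelicForm E 3 J).map (adeleToLocal E v))]
    exact congrArg _ (funext fun x => Φ.symm_apply_apply x)
  -- conjugation commutes with `map` of matrices
  have hmapc : ∀ {m n : ℕ} (Y : Matrix (Fin m) (Fin n) (LocalRing E v)), (Y.map (conjLocal E c v)).map Φ.toRingHom = (Y.map Φ.toRingHom).map σ :=
    fun Y => by rw [Matrix.map_map, Matrix.map_map]; exact Matrix.ext fun i j => hΦc _
  -- the field-level data at `w`
  have hσσ : ∀ y, σ (σ y) = y := galAdicCompletionMap_galAdicCompletionMap_of_smul_eq (F := F) c w hc hw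
  have h2 : (2 : w.1.adicCompletion E) ≠ 0 := two_ne_zero
  have hJw : ((placeForm J w.1).map σ)ᵀ = placeForm J w.1 := placeForm_hermitian_of_smul_eq c w J hJh hw
  have hJwdet : (placeForm J w.1).det ≠ 0 := by
    rw [placeForm, ← RingHom.mapMatrix_apply, ← RingHom.map_det]
    exact (map_ne_zero _).2 hJdet
  have hnull : ∀ Y : Matrix (Fin 3) (Fin 2) (LocalRing E v), (Y.map (conjLocal E c v))ᵀ * ((adelicForm E 3 J).map (adeleToLocal E v) : Matrix (Fin 3) (Fin 3) (LocalRing E v)) * Y = 0 →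
      ((Y.map Φ.toRingHom).map σ)ᵀ * placeForm J w.1 * Y.map Φ.toRingHom = 0 := fun Y hY => by
    have h := congrArg (fun Z : Matrix (Fin 2) (Fin 2) (LocalRing E v) => Z.map Φ.toRingHom) hY
    simp only [Matrix.map_mul, Matrix.map_zero _ (map_zero _)] at h
    rw [Matrix.transpose_map, hmapc, hΦJ] at h
    exact h
  have hne : ∀ Y : Matrix (Fin 3) (Fin 2) (LocalRing E v), Y ≠ 0 → Y.map Φ.toRingHom ≠ 0 := fun Y hY h => hY (by
    have h' := congrArg (fun Z : Matrix (Fin 3) (Fin 2) (w.1.adicCompletion E) => Z.map Φ.symm.toRingHom) h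
    simp only [Matrix.map_map, Matrix.map_zero _ (map_zero _)] at h'
    rw [← h']
    exact (Matrix.ext fun i j => (Φ.symm_apply_apply _).symm))
  obtain ⟨gw, hgw, aw, haw, hmul⟩ := exists_unitary_mul_mul_eq_of_null (w.1.adicCompletion E) σ hσσ h2 (placeForm J w.1) hJw hJwdet
    (X.map Φ.toRingHom) (X'.map Φ.toRingHom) (hnull X hX) (hne X hX0) (hnull X' hX') (hne X' hX'0)
  -- transport back along `Φ⁻¹`
  have hg : Matrix.GeneralLinearGroup.map Φ.symm.toRingHom gw ∈ UnitaryGroup.«local» E c 3 J v := by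
    have hm := (unitaryGroupOfFormMap Φ.symm.toRingHom hΦc' (placeForm J w.1) ⟨gw, hgw⟩).2
    show ((Units.val (Matrix.GeneralLinearGroup.map Φ.symm.toRingHom gw)).map (conjLocal E c v))ᵀ * (adelicForm E 3 J).map (adeleToLocal E v) *
        Units.val (Matrix.GeneralLinearGroup.map Φ.symm.toRingHom gw) = (adelicForm E 3 J).map (adeleToLocal E v)
    rw [← hΦJ']
    exact hm
  refine ⟨⟨_, hg⟩, aw.map Φ.symm.toRingHom, ?_, ?_⟩
  · rw [← RingHom.mapMatrix_apply, ← RingHom.map_det]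
    exact haw.map _
  · have h := congrArg (fun Z : Matrix (Fin 3) (Fin 2) (w.1.adicCompletion E) => Z.map Φ.symm.toRingHom) hmul
    simp only [Matrix.map_mul, Matrix.map_map] at h
    have hid : ∀ Y : Matrix (Fin 3) (Fin 2) (LocalRing E v), Y.map (⇑Φ.symm.toRingHom ∘ ⇑Φ.toRingHom) = Y :=
      fun Y => Matrix.ext fun i j => Φ.symm_apply_apply _
    rw [hid, hid] at h
    exact h

end Summit.HodgeConjecture.HodgeConjecture.Cruxes.HLiu418.K2LiuNullConeOrbitsNonsplitLocal

end
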